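import Summits.Parity.GeneralizedHardyLittlewood.Theorems.PrimeLevelFamEdgeMomentsBeyondDiagonalDiagRemFourFourFamilies
import Summits.Parity.GeneralizedHardyLittlewood.Theorems.PrimeLevelFamEdgeMomentsBeyondDiagonalDiagRemFourFourProfile
import HarnessLib

/-!
# Route `PrimeLevelFamEdge`, crux K_A `MomentsBeyondDiagonal` (stmt-Parity-20007), line «petersson_layers» v4, stub `stub_diag`:
# **the inner `(k₁,k₂)` estimate of (R₄₄) in ABSTRACT kernel coordinates** — `…FourFourProfile.abs_profile_weight_le₄₄` (the 139-term
# monomial bookkeeping) ∘ `…FourFourFamilies.remainder_families₄₄` (the nine family envelopes, generic) ∘ the envelope arithmetic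

For 25 abstract kernels `R_ab` with the data of `…DiagRemFourFourKernelsAll.twoSeq_twentyfive₄₄` (two-sequence estimate, common `C₀`, envelope
exponent `N`; pointwise bounds with exponent `M ≤ N` for `a + b ≤ 4`): for every profile `P` with `P(0) = 0` there is `C_P ≥ 0` such that for all
`n ≥ 1`, `Y ≥ 1`, `α > 0`, `K₁` with `2αK₁Y ≤ 1`, `|β| ≤ Λ`, `log Y ≤ Λ`, `log Y ≤ L`, `L > 0`, `Λ ≥ 1`:
`|Σ_{k₁,k₂≤Y} a_n(k₁)P(ℓ⁺₁/L)a_n(k₂)P(ℓ⁺₂/L)·Wt₄₄(k₁,k₂)| ≤ C_P·C₀·D(n)²·Λ¹⁰·(√(2αK₁Y) + x^N/(1+log K₁)^A)`, `x = 1+|log 2αY²|`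
(`Wt₄₄` = the order-`(4,4)` remainder weight of `abs_monomial_weight_le₄₄` with `P_j(k) = Σ_{p∣k}logʲp` and the kernels at `R_ab(αk₁k₂)`).

What remains for (R₄₄) after this file is COORDINATES ONLY: instantiate `R_ab` with the 25 explicit kernels of `twoSeq_twentyfive₄₄` (`N = 10`,
`M = 5`), `α = g²/Q²`, `β = log Q − log g`, `Y = M/n`, `L = log M` (the `Q`-coordinate bridge `selbergRem_inner_eq`-style of `…ThreeThreeEstimate`),
and sum over `(c,g)` with `…DiagRemOuterPow` — no further analytic input.

* `pow_mul_pow_le_aux` — `Λᵃ·tᵇ ≤ 2¹⁰Λ¹⁰` for `a + b ≤ 10`, `0 ≤ t ≤ 2Λ`, `Λ ≥ 1`;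
* `abs_inner_rem_abstract_le₄₄` — **the inner estimate in abstract coordinates.**

Def-free; theorems only. Helper `--supports stmt-Parity-20007`; closes nothing; K_A, K_B and the Parity summit are NOT proved;
nothing about Landau–Siegel zeros.

## References
* E. Kowalski, P. Michel, J. VanderKam, J. reine angew. Math. 526 (2000), (23)–(28) and Prop. 5.1 p. 18.
  [cite: KowalskiMichelVanderKam2000, (23)–(28) and Prop. 5.1 — derivation (order-(4,4) remainder, inner sums)]
-/

noncomputable section

open Real Finset Polynomial

namespace Summit.Parity.GeneralizedHardyLittlewood.Theorems.MomentsBeyondDiagonal.DiagCorner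

open Literature.NumberTheory.LFunctions.KMV2000.MollifierMainTerm (W)
open Summit.Parity.GeneralizedHardyLittlewood.Theorems.BeyondDiagonalBeatsQuarter.KernelFormXSq
  (copTauW divWeight divWeight_nonneg one_le_divWeight)
open Summit.Parity.GeneralizedHardyLittlewood.Theorems.BeyondDiagonalBeatsQuarter.Corner

/-- `Λᵃ·tᵇ ≤ 2¹⁰·Λ¹⁰` for `a + b ≤ 10`, `0 ≤ t ≤ 2Λ`, `Λ ≥ 1`. [folklore] -/
theorem pow_mul_pow_le_aux {Λ t : ℝ} (hΛ : 1 ≤ Λ) (ht0 : 0 ≤ t) (ht : t ≤ 2 * Λ) (a b : ℕ) (hab : a + b ≤ 10) :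
    Λ ^ a * t ^ b ≤ 2 ^ 10 * Λ ^ 10 := by
  have h1 : t ^ b ≤ (2 * Λ) ^ b := pow_le_pow_left₀ ht0 ht b
  have h2 : Λ ^ a * (2 * Λ) ^ b = 2 ^ b * Λ ^ (a + b) := by rw [mul_pow, pow_add]; ring
  have h3 : (2 : ℝ) ^ b ≤ 2 ^ 10 := pow_le_pow_right₀ (by norm_num) (by omega)
  have h4 : Λ ^ (a + b) ≤ Λ ^ 10 := pow_le_pow_right₀ hΛ hab
  calc Λ ^ a * t ^ b ≤ Λ ^ a * (2 * Λ) ^ b := mul_le_mul_of_nonneg_left h1 (by positivity)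
    _ = 2 ^ b * Λ ^ (a + b) := h2
    _ ≤ 2 ^ 10 * Λ ^ 10 := mul_le_mul h3 h4 (by positivity) (by positivity)

set_option maxHeartbeats 6400000 in
/-- **The inner estimate of (R₄₄) in abstract kernel coordinates** (see the module docstring).
[cite: KowalskiMichelVanderKam2000, (23)–(28) and Prop. 5.1 — derivation (order-(4,4) remainder, inner sums)] -/
theorem abs_inner_rem_abstract_le₄₄ (A : ℕ) {N M : ℕ} (hMN : M ≤ N) {C₀ : ℝ} (hC₀ : 0 ≤ C₀)
    {R₀₀ R₀₁ R₀₂ R₀₃ R₀₄ R₁₀ R₁₁ R₁₂ R₁₃ R₁₄ R₂₀ R₂₁ R₂₂ R₂₃ R₂₄ R₃₀ R₃₁ R₃₂ R₃₃ R₃₄ R₄₀ R₄₁ R₄₂ R₄₃ R₄₄ : ℝ → ℝ}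
    (hall : ∀ R : ℝ → ℝ, (R = R₀₀ ∨ R = R₀₁ ∨ R = R₀₂ ∨ R = R₀₃ ∨ R = R₀₄ ∨ R = R₁₀ ∨ R = R₁₁ ∨ R = R₁₂ ∨ R = R₁₃ ∨ R = R₁₄ ∨ R = R₂₀ ∨ R = R₂₁ ∨ R = R₂₂ ∨ R = R₂₃ ∨ R = R₂₄ ∨ R = R₃₀ ∨ R = R₃₁ ∨ R = R₃₂ ∨ R = R₃₃ ∨ R = R₃₄ ∨ R = R₄₀ ∨ R = R₄₁ ∨ R = R₄₂ ∨ R = R₄₃ ∨ R = R₄₄) →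
      ∀ (a₁ a₂ : ℕ → ℝ) (Y α B η : ℝ) (K₁ i j : ℕ), 1 ≤ Y → 0 < α → 1 ≤ i → 1 ≤ j →
        (∀ e : ℕ, e ≤ ⌊Y⌋₊ → |∑ k ∈ Icc 1 e, a₂ k| ≤ B) → (∀ e : ℕ, K₁ ≤ e → |∑ k ∈ Icc 1 e, a₁ k| ≤ η) →
        2 * α * K₁ * Y ≤ 1 →
      |∑ k₁ ∈ Icc 1 ⌊Y⌋₊, ∑ k₂ ∈ Icc 1 ⌊Y⌋₊,
          a₁ k₁ * a₂ k₂ * ellp Y k₁ ^ i * ellp Y k₂ ^ j * R (α * k₁ * k₂)| ≤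
        (∑ k ∈ Icc 1 ⌊Y⌋₊, |a₁ k| * ellp Y k ^ i) * (B * (Real.log Y ^ j * (3 * C₀ * Real.sqrt (2 * α * K₁ * Y)))) +
          (∑ k ∈ Icc 1 ⌊Y⌋₊, |a₂ k| * ellp Y k ^ j) *
            ((2 * η) * (Real.log Y ^ i * (9 * C₀ * (1 + |Real.log (2 * α * Y ^ 2)|) ^ N))))
    (hpw : ∀ R : ℝ → ℝ, (R = R₀₀ ∨ R = R₀₁ ∨ R = R₀₂ ∨ R = R₀₃ ∨ R = R₀₄ ∨ R = R₁₀ ∨ R = R₁₁ ∨ R = R₁₂ ∨ R = R₁₃ ∨ R = R₂₀ ∨ R = R₂₁ ∨ R = R₂₂ ∨ R = R₃₀ ∨ R = R₃₁ ∨ R = R₄₀) →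
      (∀ y : ℝ, 0 < y → y ≤ 1 → |R y| ≤ C₀ * Real.sqrt y) ∧ (∀ y : ℝ, 1 ≤ y → |R y| ≤ C₀ * (1 + Real.log y) ^ M)) :
    ∃ K : ℝ, 0 ≤ K ∧ ∀ (P : ℝ[X]), P.coeff 0 = 0 → ∀ n : ℕ, n ≠ 0 → ∀ (Y α β Λ L : ℝ) (K₁ : ℕ), 1 ≤ Y → 0 < α →
      2 * α * K₁ * Y ≤ 1 → 1 ≤ Λ → |β| ≤ Λ → Real.log Y ≤ Λ → 0 < L → Real.log Y ≤ L →
    |∑ k₁ ∈ Icc 1 ⌊Y⌋₊, ∑ k₂ ∈ Icc 1 ⌊Y⌋₊,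
        copTauW n k₁ * P.eval (ellp Y k₁ / L) * (copTauW n k₂ * P.eval (ellp Y k₂ / L)) *
          (((2 * β + ellp Y k₁ + ellp Y k₂) ^ 8 - 4 * (2 * β + ellp Y k₁ + ellp Y k₂) ^ 6 * ((∑ p ∈ k₁.primeFactors, Real.log p ^ 2) + (∑ p ∈ k₂.primeFactors, Real.log p ^ 2)) + 18 * (2 * β + ellp Y k₁ + ellp Y k₂) ^ 4 * ((∑ p ∈ k₁.primeFactors, Real.log p ^ 2) + (∑ p ∈ k₂.primeFactors, Real.log p ^ 2)) ^ 2 - 60 * (2 * β + ellp Y k₁ + ellp Y k₂) ^ 2 * ((∑ p ∈ k₁.primeFactors, Real.log p ^ 2) + (∑ p ∈ k₂.primeFactors, Real.log p ^ 2)) ^ 3 - 12 * (2 * β + ellp Y k₁ + ellp Y k₂) ^ 4 * ((∑ p ∈ k₁.primeFactors, Real.log p ^ 4) + (∑ p ∈ k₂.primeFactors, Real.log p ^ 4)) + 120 * (2 * β + ellp Y k₁ + ellp Y k₂) ^ 2 * ((∑ p ∈ k₁.primeFactors, Real.log p ^ 2) + (∑ p ∈ k₂.primeFactors, Real.log p ^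 2)) * ((∑ p ∈ k₁.primeFactors, Real.log p ^ 4) + (∑ p ∈ k₂.primeFactors, Real.log p ^ 4)) + 105 * ((∑ p ∈ k₁.primeFactors, Real.log p ^ 2) + (∑ p ∈ k₂.primeFactors, Real.log p ^ 2)) ^ 4 - 64 * (2 * β + ellp Y k₁ + ellp Y k₂) ^ 2 * ((∑ p ∈ k₁.primeFactors, Real.log p ^ 6) + (∑ p ∈ k₂.primeFactors, Real.log p ^ 6)) - 420 * ((∑ p ∈ k₁.primeFactors, Real.log p ^ 2) + (∑ p ∈ k₂.primeFactors, Real.log p ^ 2)) ^ 2 * ((∑ p ∈ k₁.primeFactors, Real.log p ^ 4) + (∑ p ∈ k₂.primeFactors, Real.log p ^ 4)) + 448 * ((∑ p ∈ k₁.primeFactors, Real.log p ^ 2) + (∑ p ∈ k₂.primeFactors, Real.log p ^ 2)) * ((∑ p ∈ k₁.primeFactors, Real.log p ^ 6) + (∑ p ∈ k₂.primeFactors, Real.log p ^ 6)) + 140 * ((∑ p ∈ k₁.primeFactors, Real.log p ^ 4) + (∑ p ∈ k₂.primeFactors, Real.log p ^ 4)) ^ 2 - 272 * ((∑ p ∈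 k₁.primeFactors, Real.log p ^ 8) + (∑ p ∈ k₂.primeFactors, Real.log p ^ 8))) / 256 * R₀₀ (α * k₁ * k₂) +
            ((2 * β + ellp Y k₁ + ellp Y k₂) ^ 7 - 3 * (2 * β + ellp Y k₁ + ellp Y k₂) ^ 5 * ((∑ p ∈ k₁.primeFactors, Real.log p ^ 2) + (∑ p ∈ k₂.primeFactors, Real.log p ^ 2)) + 9 * (2 * β + ellp Y k₁ + ellp Y k₂) ^ 3 * ((∑ p ∈ k₁.primeFactors, Real.log p ^ 2) + (∑ p ∈ k₂.primeFactors, Real.log p ^ 2)) ^ 2 - 15 * (2 * β + ellp Y k₁ + ellp Y k₂) * ((∑ p ∈ k₁.primeFactors, Real.log p ^ 2) + (∑ p ∈ k₂.primeFactors, Real.log p ^ 2)) ^ 3 - 6 * (2 * β + ellp Y k₁ + ellp Y k₂) ^ 3 * ((∑ p ∈ k₁.primeFactors, Real.log p ^ 4) + (∑ p ∈ k₂.primeFactors, Real.log p ^ 4)) + 30 * (2 * β + ellp Y k₁ + ellp Y k₂) * ((∑ p ∈ k₁.primeFactors, Real.log p ^ 2) + (∑ p ∈ k₂.primeFactors,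 Real.log p ^ 2)) * ((∑ p ∈ k₁.primeFactors, Real.log p ^ 4) + (∑ p ∈ k₂.primeFactors, Real.log p ^ 4)) - 16 * (2 * β + ellp Y k₁ + ellp Y k₂) * ((∑ p ∈ k₁.primeFactors, Real.log p ^ 6) + (∑ p ∈ k₂.primeFactors, Real.log p ^ 6))) / 32 * R₀₁ (α * k₁ * k₂) +
            (3 * (2 * β + ellp Y k₁ + ellp Y k₂) ^ 6 - 3 * (2 * β + ellp Y k₁ + ellp Y k₂) ^ 4 * ((∑ p ∈ k₁.primeFactors, Real.log p ^ 2) + (∑ p ∈ k₂.primeFactors, Real.log p ^ 2)) - 9 * (2 * β + ellp Y k₁ + ellp Y k₂) ^ 2 * ((∑ p ∈ k₁.primeFactors, Real.log p ^ 2) + (∑ p ∈ k₂.primeFactors, Real.log p ^ 2)) ^ 2 + 6 * (2 * β + ellp Y k₁ + ellp Y k₂) ^ 2 * ((∑ p ∈ k₁.primeFactors, Real.log p ^ 4) + (∑ p ∈ k₂.primeFactors, Real.log p ^ 4)) + 45 * ((∑ p ∈ k₁.primeFactors, Real.log p ^ 2) + (∑ p ∈ k₂.primeFactors, Real.log p ^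 2)) ^ 3 - 90 * ((∑ p ∈ k₁.primeFactors, Real.log p ^ 2) + (∑ p ∈ k₂.primeFactors, Real.log p ^ 2)) * ((∑ p ∈ k₁.primeFactors, Real.log p ^ 4) + (∑ p ∈ k₂.primeFactors, Real.log p ^ 4)) + 48 * ((∑ p ∈ k₁.primeFactors, Real.log p ^ 6) + (∑ p ∈ k₂.primeFactors, Real.log p ^ 6))) / 32 * R₀₂ (α * k₁ * k₂) +
            ((2 * β + ellp Y k₁ + ellp Y k₂) ^ 5 + 2 * (2 * β + ellp Y k₁ + ellp Y k₂) ^ 3 * ((∑ p ∈ k₁.primeFactors, Real.log p ^ 2) + (∑ p ∈ k₂.primeFactors, Real.log p ^ 2)) - 9 * (2 * β + ellp Y k₁ + ellp Y k₂) * ((∑ p ∈ k₁.primeFactors, Real.log p ^ 2) + (∑ p ∈ k₂.primeFactors, Real.log p ^ 2)) ^ 2 + 6 * (2 * β + ellp Y k₁ + ellp Y k₂) * ((∑ p ∈ k₁.primeFactors, Real.log p ^ 4) + (∑ p ∈ k₂.primeFactors, Real.log p ^ 4))) / 8 * R₀₃ (α * k₁ * k₂) +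
            ((2 * β + ellp Y k₁ + ellp Y k₂) ^ 4 + 6 * (2 * β + ellp Y k₁ + ellp Y k₂) ^ 2 * ((∑ p ∈ k₁.primeFactors, Real.log p ^ 2) + (∑ p ∈ k₂.primeFactors, Real.log p ^ 2)) + 3 * ((∑ p ∈ k₁.primeFactors, Real.log p ^ 2) + (∑ p ∈ k₂.primeFactors, Real.log p ^ 2)) ^ 2 - 2 * ((∑ p ∈ k₁.primeFactors, Real.log p ^ 4) + (∑ p ∈ k₂.primeFactors, Real.log p ^ 4))) / 16 * R₀₄ (α * k₁ * k₂) +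
            ((2 * β + ellp Y k₁ + ellp Y k₂) ^ 7 - 3 * (2 * β + ellp Y k₁ + ellp Y k₂) ^ 5 * ((∑ p ∈ k₁.primeFactors, Real.log p ^ 2) + (∑ p ∈ k₂.primeFactors, Real.log p ^ 2)) + 9 * (2 * β + ellp Y k₁ + ellp Y k₂) ^ 3 * ((∑ p ∈ k₁.primeFactors, Real.log p ^ 2) + (∑ p ∈ k₂.primeFactors, Real.log p ^ 2)) ^ 2 - 15 * (2 * β + ellp Y k₁ + ellp Y k₂) * ((∑ p ∈ k₁.primeFactors, Real.log p ^ 2) + (∑ p ∈ k₂.primeFactors, Real.log p ^ 2)) ^ 3 - 6 * (2 * β + ellp Y k₁ + ellp Y k₂) ^ 3 * ((∑ p ∈ k₁.primeFactors, Real.log p ^ 4) + (∑ p ∈ k₂.primeFactors, Real.log p ^ 4)) + 30 * (2 * β + ellp Y k₁ + ellp Y k₂) * ((∑ p ∈ k₁.primeFactors, Real.log p ^ 2) + (∑ p ∈ k₂.primeFactors, Real.log p ^ 2)) * ((∑ p ∈ k₁.primeFactors, Real.log p ^ 4) + (∑ p ∈ k₂.primeFactors, Real.log p ^ 4)) - 16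 * (2 * β + ellp Y k₁ + ellp Y k₂) * ((∑ p ∈ k₁.primeFactors, Real.log p ^ 6) + (∑ p ∈ k₂.primeFactors, Real.log p ^ 6))) / 32 * R₁₀ (α * k₁ * k₂) +
            ((2 * β + ellp Y k₁ + ellp Y k₂) ^ 6 - 3 * (2 * β + ellp Y k₁ + ellp Y k₂) ^ 4 * ((∑ p ∈ k₁.primeFactors, Real.log p ^ 2) + (∑ p ∈ k₂.primeFactors, Real.log p ^ 2)) + 9 * (2 * β + ellp Y k₁ + ellp Y k₂) ^ 2 * ((∑ p ∈ k₁.primeFactors, Real.log p ^ 2) + (∑ p ∈ k₂.primeFactors, Real.log p ^ 2)) ^ 2 - 6 * (2 * β + ellp Y k₁ + ellp Y k₂) ^ 2 * ((∑ p ∈ k₁.primeFactors, Real.log p ^ 4) + (∑ p ∈ k₂.primeFactors, Real.log p ^ 4)) - 15 * ((∑ p ∈ k₁.primeFactors, Real.log p ^ 2) + (∑ p ∈ k₂.primeFactors, Real.log p ^ 2)) ^ 3 + 30 * ((∑ p ∈ k₁.primeFactors, Real.log p ^ 2) + (∑ p ∈ k₂.primeFactors, Real.log p ^ 2)) * ((∑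 p ∈ k₁.primeFactors, Real.log p ^ 4) + (∑ p ∈ k₂.primeFactors, Real.log p ^ 4)) - 16 * ((∑ p ∈ k₁.primeFactors, Real.log p ^ 6) + (∑ p ∈ k₂.primeFactors, Real.log p ^ 6))) / 4 * R₁₁ (α * k₁ * k₂) +
            (3 * (2 * β + ellp Y k₁ + ellp Y k₂) ^ 5 - 6 * (2 * β + ellp Y k₁ + ellp Y k₂) ^ 3 * ((∑ p ∈ k₁.primeFactors, Real.log p ^ 2) + (∑ p ∈ k₂.primeFactors, Real.log p ^ 2)) + 9 * (2 * β + ellp Y k₁ + ellp Y k₂) * ((∑ p ∈ k₁.primeFactors, Real.log p ^ 2) + (∑ p ∈ k₂.primeFactors, Real.log p ^ 2)) ^ 2 - 6 * (2 * β + ellp Y k₁ + ellp Y k₂) * ((∑ p ∈ k₁.primeFactors, Real.log p ^ 4) + (∑ p ∈ k₂.primeFactors, Real.log p ^ 4))) / 4 * R₁₂ (α * k₁ * k₂) +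
            ((2 * β + ellp Y k₁ + ellp Y k₂) ^ 4 - 3 * ((∑ p ∈ k₁.primeFactors, Real.log p ^ 2) + (∑ p ∈ k₂.primeFactors, Real.log p ^ 2)) ^ 2 + 2 * ((∑ p ∈ k₁.primeFactors, Real.log p ^ 4) + (∑ p ∈ k₂.primeFactors, Real.log p ^ 4))) * R₁₃ (α * k₁ * k₂) +
            ((2 * β + ellp Y k₁ + ellp Y k₂) ^ 3 + 3 * (2 * β + ellp Y k₁ + ellp Y k₂) * ((∑ p ∈ k₁.primeFactors, Real.log p ^ 2) + (∑ p ∈ k₂.primeFactors, Real.log p ^ 2))) / 2 * R₁₄ (α * k₁ * k₂) +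
            (3 * (2 * β + ellp Y k₁ + ellp Y k₂) ^ 6 - 3 * (2 * β + ellp Y k₁ + ellp Y k₂) ^ 4 * ((∑ p ∈ k₁.primeFactors, Real.log p ^ 2) + (∑ p ∈ k₂.primeFactors, Real.log p ^ 2)) - 9 * (2 * β + ellp Y k₁ + ellp Y k₂) ^ 2 * ((∑ p ∈ k₁.primeFactors, Real.log p ^ 2) + (∑ p ∈ k₂.primeFactors, Real.log p ^ 2)) ^ 2 + 6 * (2 * β + ellp Y k₁ + ellp Y k₂) ^ 2 * ((∑ p ∈ k₁.primeFactors, Real.log p ^ 4) + (∑ p ∈ k₂.primeFactors, Real.log p ^ 4)) + 45 * ((∑ p ∈ k₁.primeFactors, Real.log p ^ 2) + (∑ p ∈ k₂.primeFactors, Real.log p ^ 2)) ^ 3 - 90 * ((∑ p ∈ k₁.primeFactors, Real.log p ^ 2) + (∑ p ∈ k₂.primeFactors, Real.log p ^ 2)) * ((∑ p ∈ k₁.primeFactors, Real.log p ^ 4) + (∑ p ∈ k₂.primeFactors, Real.log p ^ 4)) + 48 * ((∑ p ∈ k₁.primeFactors, Real.log p ^ 6) + (∑ p ∈ k₂.primeFactors,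 Real.log p ^ 6))) / 32 * R₂₀ (α * k₁ * k₂) +
            (3 * (2 * β + ellp Y k₁ + ellp Y k₂) ^ 5 - 6 * (2 * β + ellp Y k₁ + ellp Y k₂) ^ 3 * ((∑ p ∈ k₁.primeFactors, Real.log p ^ 2) + (∑ p ∈ k₂.primeFactors, Real.log p ^ 2)) + 9 * (2 * β + ellp Y k₁ + ellp Y k₂) * ((∑ p ∈ k₁.primeFactors, Real.log p ^ 2) + (∑ p ∈ k₂.primeFactors, Real.log p ^ 2)) ^ 2 - 6 * (2 * β + ellp Y k₁ + ellp Y k₂) * ((∑ p ∈ k₁.primeFactors, Real.log p ^ 4) + (∑ p ∈ k₂.primeFactors, Real.log p ^ 4))) / 4 * R₂₁ (α * k₁ * k₂) +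
            (9 * (2 * β + ellp Y k₁ + ellp Y k₂) ^ 4 - 18 * (2 * β + ellp Y k₁ + ellp Y k₂) ^ 2 * ((∑ p ∈ k₁.primeFactors, Real.log p ^ 2) + (∑ p ∈ k₂.primeFactors, Real.log p ^ 2)) + 27 * ((∑ p ∈ k₁.primeFactors, Real.log p ^ 2) + (∑ p ∈ k₂.primeFactors, Real.log p ^ 2)) ^ 2 - 18 * ((∑ p ∈ k₁.primeFactors, Real.log p ^ 4) + (∑ p ∈ k₂.primeFactors, Real.log p ^ 4))) / 4 * R₂₂ (α * k₁ * k₂) +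
            (3 * (2 * β + ellp Y k₁ + ellp Y k₂) ^ 3 - 3 * (2 * β + ellp Y k₁ + ellp Y k₂) * ((∑ p ∈ k₁.primeFactors, Real.log p ^ 2) + (∑ p ∈ k₂.primeFactors, Real.log p ^ 2))) * R₂₃ (α * k₁ * k₂) +
            (3 * (2 * β + ellp Y k₁ + ellp Y k₂) ^ 2 + 3 * ((∑ p ∈ k₁.primeFactors, Real.log p ^ 2) + (∑ p ∈ k₂.primeFactors, Real.log p ^ 2))) / 2 * R₂₄ (α * k₁ * k₂) +
            ((2 * β + ellp Y k₁ + ellp Y k₂) ^ 5 + 2 * (2 * β + ellp Y k₁ + ellp Y k₂) ^ 3 * ((∑ p ∈ k₁.primeFactors, Real.log p ^ 2) + (∑ p ∈ k₂.primeFactors, Real.log p ^ 2)) - 9 * (2 * β + ellp Y k₁ + ellp Y k₂) * ((∑ p ∈ k₁.primeFactors, Real.log p ^ 2) + (∑ p ∈ k₂.primeFactors, Real.log p ^ 2)) ^ 2 + 6 * (2 * β + ellp Y k₁ + ellp Y k₂) * ((∑ p ∈ k₁.primeFactors, Real.log p ^ 4) + (∑ p ∈ k₂.primeFactors, Real.log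 p ^ 4))) / 8 * R₃₀ (α * k₁ * k₂) +
            ((2 * β + ellp Y k₁ + ellp Y k₂) ^ 4 - 3 * ((∑ p ∈ k₁.primeFactors, Real.log p ^ 2) + (∑ p ∈ k₂.primeFactors, Real.log p ^ 2)) ^ 2 + 2 * ((∑ p ∈ k₁.primeFactors, Real.log p ^ 4) + (∑ p ∈ k₂.primeFactors, Real.log p ^ 4))) * R₃₁ (α * k₁ * k₂) +
            (3 * (2 * β + ellp Y k₁ + ellp Y k₂) ^ 3 - 3 * (2 * β + ellp Y k₁ + ellp Y k₂) * ((∑ p ∈ k₁.primeFactors, Real.log p ^ 2) + (∑ p ∈ k₂.primeFactors, Real.log p ^ 2))) * R₃₂ (α * k₁ * k₂) +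
            (4 * (2 * β + ellp Y k₁ + ellp Y k₂) ^ 2 - 4 * ((∑ p ∈ k₁.primeFactors, Real.log p ^ 2) + (∑ p ∈ k₂.primeFactors, Real.log p ^ 2))) * R₃₃ (α * k₁ * k₂) +
            2 * (2 * β + ellp Y k₁ + ellp Y k₂) * R₃₄ (α * k₁ * k₂) +
            ((2 * β + ellp Y k₁ + ellp Y k₂) ^ 4 + 6 * (2 * β + ellp Y k₁ + ellp Y k₂) ^ 2 * ((∑ p ∈ k₁.primeFactors, Real.log p ^ 2) + (∑ p ∈ k₂.primeFactors, Real.log p ^ 2)) + 3 * ((∑ p ∈ k₁.primeFactors, Real.log p ^ 2) + (∑ p ∈ k₂.primeFactors, Real.log p ^ 2)) ^ 2 - 2 * ((∑ p ∈ k₁.primeFactors, Real.log p ^ 4) + (∑ p ∈ k₂.primeFactors, Real.log p ^ 4))) / 16 * R₄₀ (α * k₁ * k₂) +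
            ((2 * β + ellp Y k₁ + ellp Y k₂) ^ 3 + 3 * (2 * β + ellp Y k₁ + ellp Y k₂) * ((∑ p ∈ k₁.primeFactors, Real.log p ^ 2) + (∑ p ∈ k₂.primeFactors, Real.log p ^ 2))) / 2 * R₄₁ (α * k₁ * k₂) +
            (3 * (2 * β + ellp Y k₁ + ellp Y k₂) ^ 2 + 3 * ((∑ p ∈ k₁.primeFactors, Real.log p ^ 2) + (∑ p ∈ k₂.primeFactors, Real.log p ^ 2))) / 2 * R₄₂ (α * k₁ * k₂) +
            2 * (2 * β + ellp Y k₁ + ellp Y k₂) * R₄₃ (α * k₁ * k₂) +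
            R₄₄ (α * k₁ * k₂))| ≤
      (∑ i ∈ Finset.range (P.natDegree + 1), |P.coeff i|) ^ 2 *
        (K * C₀ * divWeight n ^ 2 * Λ ^ 10 * (Real.sqrt (2 * α * K₁ * Y) + (1 + |Real.log (2 * α * Y ^ 2)|) ^ N / (1 + Real.log K₁) ^ A)) := by
  obtain ⟨K, hK0, hfam⟩ := remainder_families₄₄ A hMN hC₀ hall hpw
  refine ⟨8664 * 2 ^ 10 * K, by positivity, fun P hP0 n hn Y α β Λ L K₁ hY hα hY₁ hΛ hβ hLY hL hYL ↦ ?_⟩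
  obtain ⟨f0, f2, f4, f6, f8, fB, fBD, fBS, fDD⟩ := hfam n hn Y α K₁ hY hα hY₁
  set D : ℝ := divWeight n with hDdef
  set T : ℝ := Real.sqrt (2 * α * K₁ * Y) + (1 + |Real.log (2 * α * Y ^ 2)|) ^ N / (1 + Real.log K₁) ^ A with hTdef
  have hK1 : 0 ≤ Real.log (K₁ : ℝ) := Real.log_natCast_nonneg K₁
  have hT0 : 0 ≤ T := by positivity
  have hlY0 : 0 ≤ Real.log Y := Real.log_nonneg hY
  set t : ℝ := 1 + Real.log Y with ht
  have ht0 : 0 ≤ t := by positivity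
  have ht2 : t ≤ 2 * Λ := by rw [ht]; linarith
  have hbase : 0 ≤ C₀ * (K * D ^ 2) * T := by positivity
  -- the nine envelopes
  have hΨ : ∀ e : ℕ, 0 ≤ C₀ * (K * D ^ 2 * t ^ e * T) := fun e ↦ by positivity
  have h := abs_profile_weight_le₄₄ P hP0 (a := fun k ↦ copTauW n k)
    (P2 := fun k : ℕ ↦ ∑ p ∈ k.primeFactors, Real.log p ^ 2) (P4 := fun k : ℕ ↦ ∑ p ∈ k.primeFactors, Real.log p ^ 4)
    (P6 := fun k : ℕ ↦ ∑ p ∈ k.primeFactors, Real.log p ^ 6) (P8 := fun k : ℕ ↦ ∑ p ∈ k.primeFactors, Real.log p ^ 8)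
    hY hΛ hβ hLY (hΨ 2) (hΨ 4) (hΨ 6) (hΨ 8) (hΨ 10) (hΨ 4) (hΨ 6) (hΨ 8) (hΨ 6) hL hYL f0 f2 f4 f6 f8 fB fBD fBS fDD
  refine h.trans (mul_le_mul_of_nonneg_left ?_ (by positivity))
  -- envelope arithmetic
  have e1 := pow_mul_pow_le_aux hΛ ht0 ht2 8 2 (by norm_num)
  have e2 := pow_mul_pow_le_aux hΛ ht0 ht2 6 4 (by norm_num)
  have e3 := pow_mul_pow_le_aux hΛ ht0 ht2 4 6 (by norm_num)
  have e4 := pow_mul_pow_le_aux hΛ ht0 ht2 2 8 (by norm_num)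
  have e5 := pow_mul_pow_le_aux hΛ ht0 ht2 0 10 (by norm_num)
  have e6 := pow_mul_pow_le_aux hΛ ht0 ht2 4 4 (by norm_num)
  have e7 := pow_mul_pow_le_aux hΛ ht0 ht2 2 6 (by norm_num)
  have e8 := pow_mul_pow_le_aux hΛ ht0 ht2 0 8 (by norm_num)
  have e9 := pow_mul_pow_le_aux hΛ ht0 ht2 0 6 (by norm_num)
  rw [pow_zero, one_mul] at e5 e8 e9
  have hrew : 6561 * Λ ^ 8 * (C₀ * (K * D ^ 2 * t ^ 2 * T)) + 1694 * Λ ^ 6 * (C₀ * (K * D ^ 2 * t ^ 4 * T)) +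
      94 * Λ ^ 4 * (C₀ * (K * D ^ 2 * t ^ 6 * T)) + 3 * Λ ^ 2 * (C₀ * (K * D ^ 2 * t ^ 8 * T)) + C₀ * (K * D ^ 2 * t ^ 10 * T) +
      279 * Λ ^ 4 * (C₀ * (K * D ^ 2 * t ^ 4 * T)) + 30 * Λ ^ 2 * (C₀ * (K * D ^ 2 * t ^ 6 * T)) + C₀ * (K * D ^ 2 * t ^ 8 * T) +
      C₀ * (K * D ^ 2 * t ^ 6 * T) =
      (C₀ * (K * D ^ 2) * T) * (6561 * (Λ ^ 8 * t ^ 2) + 1694 * (Λ ^ 6 * t ^ 4) + 94 * (Λ ^ 4 * t ^ 6) + 3 * (Λ ^ 2 * t ^ 8) + t ^ 10 +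
        279 * (Λ ^ 4 * t ^ 4) + 30 * (Λ ^ 2 * t ^ 6) + t ^ 8 + t ^ 6) := by ring
  rw [hrew]
  have hsum : 6561 * (Λ ^ 8 * t ^ 2) + 1694 * (Λ ^ 6 * t ^ 4) + 94 * (Λ ^ 4 * t ^ 6) + 3 * (Λ ^ 2 * t ^ 8) + t ^ 10 +
      279 * (Λ ^ 4 * t ^ 4) + 30 * (Λ ^ 2 * t ^ 6) + t ^ 8 + t ^ 6 ≤ 8664 * (2 ^ 10 * Λ ^ 10) := by linarith
  calc (C₀ * (K * D ^ 2) * T) * _ ≤ (C₀ * (K * D ^ 2) * T) * (8664 * (2 ^ 10 * Λ ^ 10)) := mul_le_mul_of_nonneg_left hsum hbase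
    _ = 8664 * 2 ^ 10 * K * C₀ * D ^ 2 * Λ ^ 10 * T := by ring

end Summit.Parity.GeneralizedHardyLittlewood.Theorems.MomentsBeyondDiagonal.DiagCorner

end
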